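import Mathlib.Geometry.Manifold.ChartedSpace
import Mathlib.Topology.MetricSpace.Thickening
import Mathlib.Topology.UniformSpace.HeineCantor
import Mathlib.Analysis.Normed.Module.Convex
import HarnessLib

/-!
# A tower of chart-convex neighbourhoods around a compact subset of a charted metric space

Topic `Literature/Geometry/Manifold`. The uniform form of "manifolds are locally contractible"
that skeletal inductions over compact pieces consume (Hatcher, *Algebraic Topology* (2002),
proof of Thm. A.7, p. 527: "since `X` is locally contractible, … by induction … choosing the
neighbourhoods small enough"; Milnor 1959, proof of Lemma 4: stars of a fine covering lie in
convex sets): given a compact `Y₀` inside an open `U` of a locally compact metric space `M`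
carrying an atlas of charts into a real normed space `H`, and a number of levels `L`, there are
radii `0 < r 0 ≤ r 1 ≤ ⋯`, a slack `ρ > 0` and, for every `q ∈ Y₀`, a chart `e_q` of the atlas
such that for every level `k < L`

  `closedBall q (r k + ρ) ⊆ e_q.source`, `e_q '' closedBall q (r k + ρ) ⊆ C_{k,q}`,
  `C_{k,q} ⊆ e_q.target`, `e_q.symm '' C_{k,q} ⊆ closedBall q (r (k+1))`

with `C_{k,q}` a ball of `H` (convex), and `closedBall q (r k) ⊆ U` for all `k ≤ L`. Thus:
whatever lies within `r k + ρ` of `q` can be coned in the coordinates of `e_q` inside `C_{k,q}`,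
and the cone lands within `r (k+1)` of `q`. PROVED
(`Literature.Geometry.Manifold.exists_chartTower`), by Lebesgue numbers and uniform continuity
of finitely many charts and their inverses on compact sets; no named facts.

## References

* A. Hatcher, *Algebraic Topology*, CUP (2002), Appendix, proof of Thm. A.7 (p. 527).
  [HatcherAT2002]
* J. Milnor, *On spaces having the homotopy type of a CW-complex*, Trans. AMS 90 (1959),
  proof of Lemma 4 (p. 279). [Milnor1959]
-/

noncomputable section

open Set Metric Function Filter Topology

namespace Literature.Geometry.Manifold

section Tower

variable {M : Type*} [MetricSpace M] {H : Type*} [NormedAddCommGroup H]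

/-- A finite conjunction of "`∃ δ > 0`" statements that are monotone in `δ` has a common
witness. [folklore] -/
theorem exists_pos_forall_finset {ι : Type*} (t : Finset ι) (P : ι → ℝ → Prop)
    (hmono : ∀ i, ∀ δ δ', 0 < δ' → δ' ≤ δ → P i δ → P i δ') (hP : ∀ i ∈ t, ∃ δ > 0, P i δ) :
    ∃ δ > 0, ∀ i ∈ t, P i δ := by
  classical
  induction t using Finset.induction_on with
  | empty => exact ⟨1, one_pos, fun i hi => absurd hi (Finset.notMem_empty i)⟩
  | insert i t hit ih =>
    obtain ⟨δ₁, hδ₁, h₁⟩ := hP i (Finset.mem_insert_self i t)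
    obtain ⟨δ₂, hδ₂, h₂⟩ := ih fun j hj => hP j (Finset.mem_insert_of_mem hj)
    refine ⟨min δ₁ δ₂, lt_min hδ₁ hδ₂, fun j hj => ?_⟩
    rcases Finset.mem_insert.1 hj with rfl | hj
    · exact hmono _ _ _ (lt_min hδ₁ hδ₂) (min_le_left _ _) h₁
    · exact hmono _ _ _ (lt_min hδ₁ hδ₂) (min_le_right _ _) (h₂ j hj)

/-- **Uniform openness of a chart inverse along a compact set**: for `Q` compact in the source
of the chart `e` and `R > 0` there is `σ > 0` such that, for every `q ∈ Q`, the ball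
`ball (e q) σ` lies in the target and is sent by `e.symm` into `ball q R`. [folklore] -/
theorem exists_ball_symm_subset [ProperSpace H] (e : OpenPartialHomeomorph M H) {Q : Set M}
    (hQ : IsCompact Q) (hQe : Q ⊆ e.source) {R : ℝ} (hR : 0 < R) :
    ∃ σ > 0, ∀ q ∈ Q, ball (e q) σ ⊆ e.target ∧ ∀ v ∈ ball (e q) σ, dist (e.symm v) q < R := by
  -- the compact image and a compact thickening inside the target
  have hKc : IsCompact (e '' Q) := hQ.image_of_continuousOn (e.continuousOn.mono hQe)
  have hKt : e '' Q ⊆ e.target := by rintro _ ⟨q, hq, rfl⟩; exact e.map_source (hQe hq)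
  obtain ⟨η, hη, hηt⟩ := hKc.exists_cthickening_subset_open e.open_target hKt
  have hTc : IsCompact (cthickening η (e '' Q)) := hKc.cthickening
  -- uniform continuity of `e.symm` there
  have huc := hTc.uniformContinuousOn_of_continuous (e.continuousOn_symm.mono hηt)
  obtain ⟨σ₁, hσ₁, hσ⟩ := Metric.uniformContinuousOn_iff.1 huc R hR
  refine ⟨min η σ₁, lt_min hη hσ₁, fun q hq => ⟨fun v hv => hηt ?_, fun v hv => ?_⟩⟩
  · exact mem_cthickening_of_dist_le v (e q) η _ ⟨q, hq, rfl⟩ (le_of_lt (lt_of_lt_of_le hv (min_le_left _ _)))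
  · have hv1 : v ∈ cthickening η (e '' Q) :=
      mem_cthickening_of_dist_le v (e q) η _ ⟨q, hq, rfl⟩ (le_of_lt (lt_of_lt_of_le hv (min_le_left _ _)))
    have hq1 : e q ∈ cthickening η (e '' Q) := self_subset_cthickening _ ⟨q, hq, rfl⟩
    have h1 := hσ v hv1 (e q) hq1 (lt_of_lt_of_le hv (min_le_right _ _))
    rwa [e.left_inv (hQe hq)] at h1

/-- **Uniform continuity of a chart along a compact set, with room**: for `Q` compact in the
source of the chart `e` (in a locally compact `M`) and `σ > 0` there is `δ > 0` such that for
every `q ∈ Q` the closed ball `closedBall q δ` lies in the source and is sent into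
`ball (e q) σ`. [folklore] -/
theorem exists_closedBall_image_subset [LocallyCompactSpace M] (e : OpenPartialHomeomorph M H)
    {Q : Set M} (hQ : IsCompact Q) (hQe : Q ⊆ e.source) {σ : ℝ} (hσ : 0 < σ) :
    ∃ δ > 0, ∀ q ∈ Q, closedBall q δ ⊆ e.source ∧ ∀ x ∈ closedBall q δ, dist (e x) (e q) < σ := by
  -- a compact neighbourhood `W` of `Q` inside the source, and a thickening of `Q` inside it
  obtain ⟨W, hWc, hQW, hWe⟩ := exists_compact_between hQ e.open_source hQe
  obtain ⟨δ₀, hδ₀, hδ₀W⟩ := hQ.exists_cthickening_subset_open isOpen_interior hQW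
  have huc := hWc.uniformContinuousOn_of_continuous (e.continuousOn.mono hWe)
  obtain ⟨δ₁, hδ₁, hδ⟩ := Metric.uniformContinuousOn_iff.1 huc σ hσ
  refine ⟨min δ₀ (δ₁ / 2), lt_min hδ₀ (half_pos hδ₁), fun q hq => ?_⟩
  have hball : closedBall q (min δ₀ (δ₁ / 2)) ⊆ W := fun x hx =>
    interior_subset (hδ₀W (mem_cthickening_of_dist_le x q δ₀ Q hq
      ((mem_closedBall.1 hx).trans (min_le_left _ _))))
  refine ⟨hball.trans hWe, fun x hx => ?_⟩
  have hqW : q ∈ W := interior_subset (hQW hq)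
  exact hδ x (hball hx) q hqW (lt_of_le_of_lt ((mem_closedBall.1 hx).trans (min_le_right _ _))
    (half_lt_self hδ₁))

variable [LocallyCompactSpace M] [ProperSpace H] [ChartedSpace H M]

/-- **One level of the tower, uniformly over a compact set**: given finitely many chart centres
`t`, compact sets `Q c ⊆ (chartAt c).source` (`c ∈ t`) and a target radius `R > 0`, there are
`σ > 0` and `δ > 0` such that for all `c ∈ t`, `q ∈ Q c`: `closedBall q δ ⊆ source`,
`chartAt c '' closedBall q δ ⊆ ball (chartAt c q) σ ⊆ target`, and
`(chartAt c).symm '' ball (chartAt c q) σ ⊆ ball q R`. [folklore] -/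
theorem exists_level (t : Finset M) (Q : M → Set M) (hQ : ∀ c ∈ t, IsCompact (Q c))
    (hQe : ∀ c ∈ t, Q c ⊆ (chartAt H c).source) {R : ℝ} (hR : 0 < R) :
    ∃ σ > 0, ∃ δ > 0, ∀ c ∈ t, ∀ q ∈ Q c, closedBall q δ ⊆ (chartAt H c).source ∧
      (∀ x ∈ closedBall q δ, dist (chartAt H c x) (chartAt H c q) < σ) ∧
      ball (chartAt H c q) σ ⊆ (chartAt H c).target ∧
      ∀ v ∈ ball (chartAt H c q) σ, dist ((chartAt H c).symm v) q < R := by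
  -- `σ` from the inverses
  obtain ⟨σ, hσ, hσP⟩ := exists_pos_forall_finset t
    (fun c σ => ∀ q ∈ Q c, ball (chartAt H c q) σ ⊆ (chartAt H c).target ∧
      ∀ v ∈ ball (chartAt H c q) σ, dist ((chartAt H c).symm v) q < R)
    (fun c σ σ' _ hle hP q hq => ⟨(ball_subset_ball hle).trans (hP q hq).1,
      fun v hv => (hP q hq).2 v (ball_subset_ball hle hv)⟩)
    (fun c hc => exists_ball_symm_subset (chartAt H c) (hQ c hc) (hQe c hc) hR)
  -- `δ` from the charts
  obtain ⟨δ, hδ, hδP⟩ := exists_pos_forall_finset t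
    (fun c δ => ∀ q ∈ Q c, closedBall q δ ⊆ (chartAt H c).source ∧
      ∀ x ∈ closedBall q δ, dist (chartAt H c x) (chartAt H c q) < σ)
    (fun c δ δ' _ hle hP q hq => ⟨(closedBall_subset_closedBall hle).trans (hP q hq).1,
      fun x hx => (hP q hq).2 x (closedBall_subset_closedBall hle hx)⟩)
    (fun c hc => exists_closedBall_image_subset (chartAt H c) (hQ c hc) (hQe c hc) hσ)
  exact ⟨σ, hσ, δ, hδ, fun c hc q hq => ⟨(hδP c hc q hq).1, (hδP c hc q hq).2,
    (hσP c hc q hq).1, (hσP c hc q hq).2⟩⟩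

/-- **The chart tower around a compact subset of a charted locally compact metric space.** For
`Y₀` compact inside the open `U` and `L` levels there are radii `r`, a slack `ρ > 0`, and for
every point `q` a chart centre `ctr q` and ball radii `σ k q`, such that: `0 < r k`,
`r k ≤ r (k+1)`, `ρ ≤ r 0`, `closedBall q (r k) ⊆ U` for `q ∈ Y₀`, `k ≤ L`, and for `k < L`,
`q ∈ Y₀`, with `e = chartAt (ctr q)`: `closedBall q (r k + ρ) ⊆ e.source`,
`e '' closedBall q (r k + ρ) ⊆ ball (e q) (σ k q) ⊆ e.target` and
`e.symm '' ball (e q) (σ k q) ⊆ closedBall q (r (k+1))` (Hatcher 2002, proof of Thm. A.7: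
the nested small neighbourhoods furnished by local contractibility, here by local convexity in
charts, made uniform over a compact set). [cite: HatcherAT2002, Thm. A.7 (proof, p. 527)] -/
theorem exists_chartTower {Y₀ U : Set M} (hY : IsCompact Y₀) (hU : IsOpen U) (hYU : Y₀ ⊆ U)
    (L : ℕ) :
    ∃ (r : ℕ → ℝ) (ρ : ℝ) (ctr : M → M) (σ : ℕ → M → ℝ),
      (∀ k, 0 < r k) ∧ (∀ k, r k ≤ r (k + 1)) ∧ 0 < ρ ∧ ρ ≤ r 0 ∧
      (∀ q ∈ Y₀, ∀ k ≤ L, closedBall q (r k) ⊆ U) ∧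
      ∀ k < L, ∀ q ∈ Y₀,
        closedBall q (r k + ρ) ⊆ (chartAt H (ctr q)).source ∧
        chartAt H (ctr q) '' closedBall q (r k + ρ) ⊆ ball (chartAt H (ctr q) q) (σ k q) ∧
        ball (chartAt H (ctr q) q) (σ k q) ⊆ (chartAt H (ctr q)).target ∧
        (chartAt H (ctr q)).symm '' ball (chartAt H (ctr q) q) (σ k q) ⊆ closedBall q (r (k + 1)) := by
  classical
  -- finitely many charts cover `Y₀`; a Lebesgue number for `U ∩ source`
  obtain ⟨t, ht⟩ : ∃ t : Finset M, Y₀ ⊆ ⋃ c ∈ t, (U ∩ (chartAt H c).source) :=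
    hY.elim_finite_subcover (fun c : M => U ∩ (chartAt H c).source)
      (fun c => hU.inter (chartAt H c).open_source)
      (fun q hq => mem_iUnion.2 ⟨q, hYU hq, mem_chart_source H q⟩)
  obtain ⟨lam, hlam, hleb⟩ := lebesgue_number_lemma_of_metric hY
    (c := fun c : ↥t => U ∩ (chartAt H (c : M)).source)
    (fun c => hU.inter (chartAt H (c : M)).open_source)
    (fun q hq => by
      obtain ⟨c, hc, hq'⟩ := mem_iUnion₂.1 (ht hq)
      exact mem_iUnion.2 ⟨⟨c, hc⟩, hq'⟩)
  -- compact sets of points served by each chart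
  have hclosed : ∀ S : Set M, IsClosed {q : M | ball q lam ⊆ S} := by
    intro S
    rw [← isOpen_compl_iff, isOpen_iff_mem_nhds]
    intro q hq
    simp only [mem_compl_iff, mem_setOf_eq, not_subset] at hq
    obtain ⟨x, hxq, hxS⟩ := hq
    rw [mem_ball] at hxq
    have hopen : IsOpen {q' : M | dist x q' < lam} := isOpen_lt (continuous_const.dist continuous_id) continuous_const
    filter_upwards [hopen.mem_nhds hxq] with q' hq'
    simp only [mem_compl_iff, mem_setOf_eq, not_subset]
    exact ⟨x, hq', hxS⟩
  set Q : M → Set M := fun c => Y₀ ∩ {q | ball q lam ⊆ U ∩ (chartAt H c).source} with hQdef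
  have hQc : ∀ c ∈ t, IsCompact (Q c) := fun c _ => hY.inter_right (hclosed _)
  have hQball : ∀ c, ∀ q ∈ Q c, ball q lam ⊆ U ∩ (chartAt H c).source := fun c q hq => hq.2
  have hQe : ∀ c ∈ t, Q c ⊆ (chartAt H c).source := fun c _ q hq =>
    (hQball c q hq (mem_ball_self hlam)).2
  -- every point of `Y₀` is served by some chart of `t`
  have hsel : ∀ q ∈ Y₀, ∃ c ∈ t, q ∈ Q c := by
    intro q hq
    obtain ⟨⟨c, hc⟩, hball⟩ := hleb q hq
    exact ⟨c, hc, hq, hball⟩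
  choose! ctr hctr hctrQ using hsel
  -- the levels, top down: `R 0 = lam / 2` is the top radius `r L`
  have hstep : ∀ R : ℝ, 0 < R → ∃ σ > 0, ∃ δ > 0, δ ≤ R ∧ ∀ c ∈ t, ∀ q ∈ Q c,
      closedBall q δ ⊆ (chartAt H c).source ∧
      (∀ x ∈ closedBall q δ, dist (chartAt H c x) (chartAt H c q) < σ) ∧
      ball (chartAt H c q) σ ⊆ (chartAt H c).target ∧
      ∀ v ∈ ball (chartAt H c q) σ, dist ((chartAt H c).symm v) q < R := by
    intro R hR
    obtain ⟨σ, hσ, δ, hδ, hP⟩ := exists_level t Q hQc hQe hR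
    refine ⟨σ, hσ, min δ R, lt_min hδ hR, min_le_right _ _, fun c hc q hq => ?_⟩
    obtain ⟨h1, h2, h3, h4⟩ := hP c hc q hq
    exact ⟨(closedBall_subset_closedBall (min_le_left _ _)).trans h1,
      fun x hx => h2 x (closedBall_subset_closedBall (min_le_left _ _) hx), h3, h4⟩
  choose! sig hsig del hdel hdelR hlev using hstep
  -- `R j` = radius at level `L - j`
  let R : ℕ → ℝ := fun j => Nat.rec (lam / 2) (fun _ Rj => del Rj / 2) j
  have hR0 : R 0 = lam / 2 := rfl
  have hRsucc : ∀ j, R (j + 1) = del (R j) / 2 := fun j => rfl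
  have hRpos : ∀ j, 0 < R j := by
    intro j
    induction j with
    | zero => rw [hR0]; exact half_pos hlam
    | succ j ih => rw [hRsucc]; exact half_pos (hdel _ ih)
  have hRmono : ∀ j, R (j + 1) ≤ R j := fun j => by
    rw [hRsucc]; linarith [hdelR _ (hRpos j), hdel _ (hRpos j)]
  have hRle : ∀ i j, i ≤ j → R j ≤ R i := by
    intro i j hij
    induction hij with
    | refl => exact le_rfl
    | step _ ih => exact (hRmono _).trans ih
  -- the data
  refine ⟨fun k => R (L - k), R L, ctr, fun k q => sig (R (L - (k + 1))), fun k => hRpos _,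
    fun k => hRle (L - (k + 1)) (L - k) (by omega), hRpos L, ?_, fun q hq k hk => ?_, fun k hk q hq => ?_⟩
  · -- `ρ = r 0 = R L ≤ R (L - 0)`
    simp
  · -- `closedBall q (r k) ⊆ U`
    intro x hx
    have h1 : R (L - k) ≤ lam / 2 := hR0 ▸ hRle 0 _ (Nat.zero_le _)
    have : x ∈ ball q lam := by
      rw [mem_ball]; exact lt_of_le_of_lt ((mem_closedBall.1 hx).trans h1) (half_lt_self hlam)
    exact (hQball (ctr q) q (hctrQ q hq) this).1
  · -- the tower at level `k < L`
    have hc := hctr q hq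
    have hqQ := hctrQ q hq
    set j := L - (k + 1) with hj
    have hjk : L - k = j + 1 := by omega
    have hRj := hRpos j
    obtain ⟨h1, h2, h3, h4⟩ := hlev (R j) hRj (ctr q) hc q hqQ
    have hrad : R (L - k) + R L ≤ del (R j) := by
      rw [hjk, hRsucc]
      have : R L ≤ R (j + 1) := hRle (j + 1) L (by omega)
      rw [hRsucc] at this
      linarith
    refine ⟨(closedBall_subset_closedBall hrad).trans h1, ?_, h3, ?_⟩
    · rintro _ ⟨x, hx, rfl⟩
      exact h2 x (closedBall_subset_closedBall hrad hx)
    · rintro _ ⟨v, hv, rfl⟩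
      show _ ∈ closedBall q (R (L - (k + 1)))
      exact mem_closedBall.2 (h4 v hv).le

end Tower

end Literature.Geometry.Manifold

end
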